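import Summits.Langlands.Langlands.Theorems.SeedReachSymmetricPower

/-!
# SeedReach — PART B (kernels): the dictionary (§4) and the kernels (§5) of the lens-3-g15 node `SeedReachNode`

Same namespace as PART A (`Summits/Langlands/Langlands/Theorems/SeedReachSymmetricPower.lean`, which carries the full header, the vocabulary,
the EQUIV node SPF, the pieces A/B/C, FRAME″, AVX and the `Iff.rfl` bridges).  This file proves: the Satake dictionary (`roots_pair`, `shadow_prod_eq_of_mul_eq`,
`arithFrobPoly_pair/_symm`, `arithFrobPolyOfSatake_one_injective`, `shadow_prod_eq`), the EQUIV `fc_of_spf` (outright) / `spf_of_fc` (mod AVX),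
the exact cut `spf_iff_pieces`, the WEAKER and NECESSITY certificates, `frame_of_host`, the deciding theorem `closes` and `langlands_iff_items`.
-/

set_option linter.unusedVariables false
set_option linter.unusedSectionVars false
set_option linter.dupNamespace false

namespace Summit.Langlands.Langlands.Theorems.SeedReach

open Polynomial
open Summit.Langlands.Langlands.Theses.SymmetricPowerAnchorSplit (AnchorlessSymTypeAutomorphy CMSymmetricPowerAutomorphy
  LowSymmetricPowerAutomorphy HilbertSymmetricPowerAutomorphy CliffordSolvableDescent SolvableAnchorTransport AvatarSymmetricPowerFrame)
open Summit.Langlands.Langlands.Theorems.MonodromyDichotomySymmetricPowerAnchor (IsPinnedGeometric IsLieIrreducible RankIH IsSymShadow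
  HasCohomologicalPartner IsWeaklyAutomorphic cm_of_langlands)

/-! ## §4 The dictionary (pure polynomial algebra) -/

/-- roots of a product of two linear factors. -/
theorem roots_pair {K : Type*} [Field K] (u w : K) : ((X - C u) * (X - C w)).roots = {u, w} := by
  rw [Polynomial.roots_mul (mul_ne_zero (X_sub_C_ne_zero u) (X_sub_C_ne_zero w)), roots_X_sub_C, roots_X_sub_C,
    Multiset.singleton_add, Multiset.insert_eq_cons]

/-- THE `Sym^(n-1)` DICTIONARY: if `{a, ar} = {x, y}` then the progression spectrum `{a^(n-1) r^j}` is `{x^i y^(n-1-i)}`. -/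
theorem shadow_prod_eq {K : Type*} [Field K] {a r x y : K} (n : ℕ)
    (h : (a = x ∧ a * r = y) ∨ (a = y ∧ a * r = x)) :
    ∏ j ∈ Finset.range n, (X - C (a ^ (n - 1) * r ^ j)) = ∏ i ∈ Finset.range n, (X - C (x ^ i * y ^ (n - 1 - i))) := by
  have hpow : ∀ j ∈ Finset.range n, a ^ (n - 1) * r ^ j = a ^ (n - 1 - j) * (a * r) ^ j := by
    intro j hj
    have hj : j ≤ n - 1 := by have := Finset.mem_range.1 hj; omega
    rw [mul_pow, ← mul_assoc, ← pow_add, Nat.sub_add_cancel hj]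
  rcases h with ⟨rfl, rfl⟩ | ⟨rfl, rfl⟩
  · rw [← Finset.prod_range_reflect (fun i => X - C (a ^ i * (a * r) ^ (n - 1 - i))) n]
    refine Finset.prod_congr rfl fun j hj => ?_
    have hj' : j ≤ n - 1 := by have := Finset.mem_range.1 hj; omega
    simp only [hpow j hj, Nat.sub_sub_self hj']
  · refine Finset.prod_congr rfl fun j hj => ?_
    rw [hpow j hj, mul_comm]

/-- THE `Sym^(n-1)` DICTIONARY from a factorised characteristic polynomial: `(X-a)(X-ar) = (X-x)(X-y)` forces
`{a, ar} = {x, y}` (the landed `Literature.NumberTheory.GaloisRepresentations.eq_and_eq_or_eq_and_eq_of_mul_X_sub_C_eq`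
of `TeichmullerLiftLocalShape`, re-derived inline from `roots_pair` because that module's import closure is unbuilt on the
farm at landing time — gate dedup p792321), hence the progression spectrum identity of `shadow_prod_eq`. -/
theorem shadow_prod_eq_of_mul_eq {K : Type*} [Field K] {a r x y : K} (n : ℕ)
    (h : (X - C a) * (X - C (a * r)) = (X - C x) * (X - C y)) :
    ∏ j ∈ Finset.range n, (X - C (a ^ (n - 1) * r ^ j)) = ∏ i ∈ Finset.range n, (X - C (x ^ i * y ^ (n - 1 - i))) := by
  classical
  refine shadow_prod_eq n ?_
  have key : ({a, a * r} : Multiset K) = {x, y} := by rw [← roots_pair a (a * r), ← roots_pair x y, h]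
  have ha : a ∈ ({x, y} : Multiset K) := by rw [← key]; exact Multiset.mem_cons_self _ _
  rw [Multiset.insert_eq_cons, Multiset.mem_cons, Multiset.mem_singleton] at ha
  rcases ha with rfl | rfl
  · left; refine ⟨rfl, ?_⟩
    have h' : ({a, a * r} : Multiset K) = {a, y} := key
    rwa [Multiset.insert_eq_cons, Multiset.insert_eq_cons, Multiset.cons_inj_right, Multiset.singleton_inj] at h'
  · right; refine ⟨rfl, ?_⟩
    have h' : ({a, a * r} : Multiset K) = {a, x} := key.trans (Multiset.pair_comm x a)
    rwa [Multiset.insert_eq_cons, Multiset.insert_eq_cons, Multiset.cons_inj_right, Multiset.singleton_inj] at h'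

/-- the L-normalised Satake polynomial of a pair. -/
theorem arithFrobPoly_pair {ℓ : ℕ} [Fact ℓ.Prime] (ι : PadicAlgCl ℓ ≃+* ℂ) (q : ℕ) (a b : ℂ) :
    Literature.NumberTheory.Automorphic.arithFrobPolyOfSatake ι q 1 ({a, b} : Multiset ℂ) =
      (X - C (ι.symm a)⁻¹) * (X - C (ι.symm b)⁻¹) := by
  rw [Literature.NumberTheory.Automorphic.arithFrobPolyOfSatake_one]
  simp [Multiset.insert_eq_cons]

/-- the L-normalised Satake polynomial of `Sym^(n-1){a,b}` is the progression product in `x = ι⁻¹(a)⁻¹, y = ι⁻¹(b)⁻¹`. -/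
theorem arithFrobPoly_symm {ℓ : ℕ} [Fact ℓ.Prime] (ι : PadicAlgCl ℓ ≃+* ℂ) (q : ℕ) (a b : ℂ) {n : ℕ} (hn : 1 ≤ n) :
    Literature.NumberTheory.Automorphic.arithFrobPolyOfSatake ι q 1 (Literature.NumberTheory.Automorphic.symmPowerParams (n - 1) a b) =
      ∏ i ∈ Finset.range n, (X - C ((ι.symm a)⁻¹ ^ i * (ι.symm b)⁻¹ ^ (n - 1 - i))) := by
  rw [Literature.NumberTheory.Automorphic.arithFrobPolyOfSatake_one, Literature.NumberTheory.Automorphic.symmPowerParams_def,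
    Multiset.map_map, Nat.sub_add_cancel hn, Finset.prod_eq_multiset_prod, Finset.range_val]
  congr 1
  refine Multiset.map_congr rfl fun i _ => ?_
  simp [map_mul, map_pow, inv_pow, mul_comm]

/-- `α ↦ arithFrobPolyOfSatake ι q 1 α` is injective (roots `ι⁻¹(a)⁻¹`, an injective function of `a`). -/
theorem arithFrobPolyOfSatake_one_injective {ℓ : ℕ} [Fact ℓ.Prime] (ι : PadicAlgCl ℓ ≃+* ℂ) (q : ℕ) :
    Function.Injective (Literature.NumberTheory.Automorphic.arithFrobPolyOfSatake ι q 1) := by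
  intro α β h
  have hr := congrArg Polynomial.roots h
  rw [Literature.NumberTheory.Automorphic.roots_arithFrobPolyOfSatake,
    Literature.NumberTheory.Automorphic.roots_arithFrobPolyOfSatake] at hr
  refine Multiset.map_injective ?_ hr
  intro a b hab
  have := congrArg (fun z : PadicAlgCl ℓ => ι z⁻¹) hab
  simpa using this

/-- a rank-2 framed representation has Frobenius characteristic polynomials of degree 2. -/
theorem natDegree_charpoly_two {K₀ : Type} [Field K₀] [NumberField K₀] {ℓ : ℕ} [Fact ℓ.Prime]
    (σ₀ : Literature.NumberTheory.GaloisRepresentations.FramedGaloisRep K₀ (PadicAlgCl ℓ) 2) (g : Field.absoluteGaloisGroup K₀) :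
    (Literature.NumberTheory.GaloisRepresentations.FramedRep.charpoly σ₀ g).natDegree = 2 := by
  unfold Literature.NumberTheory.GaloisRepresentations.FramedRep.charpoly
  rw [Matrix.charpoly_natDegree_eq_dim, Fintype.card_fin]

/-! ## §5 Kernels — the EQUIV (FC ⟺ SPF), the exact cut (SPF ⟺ A ∧ B ∧ C), the certificates, the frame and `closes` -/

/-- EQUIV, deciding direction (OUTRIGHT, no antecedent): `Sym^(n-1)` functoriality in Satake clothing gives FC in Galois clothing —
the avatar `ρ₀`'s Frobenius polynomials are read off `σ₀`'s through the shadow relation (`shadow_prod_eq`). -/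
theorem fc_of_spf (h : SymPowerFunctoriality) : CMSymmetricPowerAutomorphy := by
  intro K₀ _ _ n hcpt h6 hIH hCM ℓ _ ι σ₀ ρ₀ hρirr hρPG hρLI hSh hσirr hσPG hσLI hP
  obtain ⟨P, hPL, hev⟩ := h K₀ n hcpt h6 hIH hCM ℓ ι σ₀ hσirr hσPG hσLI hP
  obtain ⟨hρur, -⟩ := hρPG
  refine ⟨P, hPL, ?_⟩
  filter_upwards [hev, hρur] with v hv hur
  obtain ⟨a, b, hσur, hσF, hPS⟩ := hv
  refine ⟨Literature.NumberTheory.Automorphic.symmPowerParams (n - 1) a b, hPS, hur, ?_⟩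
  intro 𝔓 h𝔓 g hg
  obtain ⟨a', r, h1, h2⟩ := hSh g
  rw [h2, arithFrobPoly_symm ι _ a b (by omega)]
  exact shadow_prod_eq_of_mul_eq n ((h1.symm.trans ((hσF 𝔓 h𝔓 g hg).trans (arithFrobPoly_pair ι _ a b))))

/-- EQUIV, converse direction (modulo the print antecedent AVX): FC gives SPF — apply FC to the avatar `ρ₀ = Sym^(n-1) σ₀`, then
read the Satake parameter of `P_v` off `ρ₀`'s Frobenius polynomial at an (existing!) Frobenius element
(`primesAbove_nonempty`, `exists_isArithFrobAt_of_mem_primesAbove_holds`) via injectivity of the Satake polynomial. -/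
theorem spf_of_fc (hAV : SymPowerAvatarExists) (h : CMSymmetricPowerAutomorphy) : SymPowerFunctoriality := by
  intro K₀ _ _ n hcpt h6 hIH hCM ℓ _ ι σ₀ hσirr hσPG hσLI hP
  obtain ⟨ρ₀, hρirr, hρPG, hρLI, hSh⟩ := hAV K₀ n (by omega) ℓ σ₀ hσirr hσPG hσLI
  obtain ⟨P, hPL, hev⟩ := h K₀ n hcpt h6 hIH hCM ℓ ι σ₀ ρ₀ hρirr hρPG hρLI hSh hσirr hσPG hσLI hP
  obtain ⟨hcpt₂, π₀, hT, hπev⟩ := hP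
  refine ⟨P, hPL, ?_⟩
  filter_upwards [hev, hπev] with v hv hπv
  obtain ⟨α, hPS, hρur, hρF⟩ := hv
  obtain ⟨β, hπS, hσur, hσF⟩ := hπv
  obtain ⟨𝔓, h𝔓⟩ := v.primesAbove_nonempty
  obtain ⟨g, hg⟩ := IsDedekindDomain.HeightOneSpectrum.exists_isArithFrobAt_of_mem_primesAbove_holds h𝔓
  have hσ := hσF 𝔓 h𝔓 g hg
  have hcard : Multiset.card β = 2 := by
    have h1 := congrArg Polynomial.natDegree hσ
    rwa [Literature.NumberTheory.Automorphic.natDegree_arithFrobPolyOfSatake, natDegree_charpoly_two, eq_comm] at h1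
  obtain ⟨a, b, rfl⟩ := Multiset.card_eq_two.1 hcard
  refine ⟨a, b, hσur, hσF, ?_⟩
  obtain ⟨a', r, h1, h2⟩ := hSh g
  have key : Literature.NumberTheory.Automorphic.arithFrobPolyOfSatake ι v.residueCard 1 α =
      Literature.NumberTheory.Automorphic.arithFrobPolyOfSatake ι v.residueCard 1
        (Literature.NumberTheory.Automorphic.symmPowerParams (n - 1) a b) := by
    rw [← hρF 𝔓 h𝔓 g hg, h2, arithFrobPoly_symm ι _ a b (by omega)]
    exact shadow_prod_eq_of_mul_eq n ((h1.symm.trans (hσ.trans (arithFrobPoly_pair ι _ a b))))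
  rw [arithFrobPolyOfSatake_one_injective ι _ key] at hPS
  exact hPS

/-- THE EQUIV: FC ⟺ SPF (modulo AVX for the converse). -/
theorem fc_iff_spf (hAV : SymPowerAvatarExists) : CMSymmetricPowerAutomorphy ↔ SymPowerFunctoriality :=
  ⟨spf_of_fc hAV, fc_of_spf⟩

/-- WEAKER (1/3): piece A is SPF restricted to dial A. -/
theorem a_of_spf (h : SymPowerFunctoriality) : BaseChangeSeededSymPower := by
  intro K₀ _ _ n hcpt h6 hIH hCM ℓ _ ι σ₀ h1 h2 h3 h4 _
  exact h K₀ n hcpt h6 hIH hCM ℓ ι σ₀ h1 h2 h3 h4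

/-- WEAKER (2/3): piece B is SPF restricted to ¬A ∧ B. -/
theorem b_of_spf (h : SymPowerFunctoriality) : ThetaSeededSymPower := by
  intro K₀ _ _ n hcpt h6 hIH hCM ℓ _ ι σ₀ h1 h2 h3 h4 _ _
  exact h K₀ n hcpt h6 hIH hCM ℓ ι σ₀ h1 h2 h3 h4

/-- WEAKER (3/3): the residual C is SPF restricted to ¬A ∧ ¬B. -/
theorem c_of_spf (h : SymPowerFunctoriality) : SeedIsolatedSymPower := by
  intro K₀ _ _ n hcpt h6 hIH hCM ℓ _ ι σ₀ h1 h2 h3 h4 _ _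
  exact h K₀ n hcpt h6 hIH hCM ℓ ι σ₀ h1 h2 h3 h4

/-- EXACT CUT (←): the three pieces give SPF (excluded middle on the two dials). -/
theorem spf_of_pieces (hA : BaseChangeSeededSymPower) (hB : ThetaSeededSymPower) (hC : SeedIsolatedSymPower) :
    SymPowerFunctoriality := by
  intro K₀ _ _ n hcpt h6 hIH hCM ℓ _ ι σ₀ h1 h2 h3 h4
  by_cases hbc : BCReachable K₀ n ℓ ι σ₀
  · exact hA K₀ n hcpt h6 hIH hCM ℓ ι σ₀ h1 h2 h3 h4 hbc
  by_cases hth : ThetaReachable K₀ n ℓ ι σ₀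
  · exact hB K₀ n hcpt h6 hIH hCM ℓ ι σ₀ h1 h2 h3 h4 hbc hth
  · exact hC K₀ n hcpt h6 hIH hCM ℓ ι σ₀ h1 h2 h3 h4 hbc hth

/-- EXACT CUT: SPF ⟺ A ∧ B ∧ C. -/
theorem spf_iff_pieces : SymPowerFunctoriality ↔ (BaseChangeSeededSymPower ∧ ThetaSeededSymPower ∧ SeedIsolatedSymPower) :=
  ⟨fun h => ⟨a_of_spf h, b_of_spf h, c_of_spf h⟩, fun h => spf_of_pieces h.1 h.2.1 h.2.2⟩

/-- EXACT CUT at the target: FC ⟺ A ∧ B ∧ C (modulo AVX for →). -/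
theorem fc_iff_pieces (hAV : SymPowerAvatarExists) :
    CMSymmetricPowerAutomorphy ↔ (BaseChangeSeededSymPower ∧ ThetaSeededSymPower ∧ SeedIsolatedSymPower) :=
  (fc_iff_spf hAV).trans spf_iff_pieces

/-- pieces ⟹ FC, OUTRIGHT (the direction the deciding theorem uses). -/
theorem fc_of_pieces (hA : BaseChangeSeededSymPower) (hB : ThetaSeededSymPower) (hC : SeedIsolatedSymPower) :
    CMSymmetricPowerAutomorphy :=
  fc_of_spf (spf_of_pieces hA hB hC)

/-- A is WEAKER than the target FC (mod AVX). -/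
theorem a_of_fc (hAV : SymPowerAvatarExists) (h : CMSymmetricPowerAutomorphy) : BaseChangeSeededSymPower := a_of_spf (spf_of_fc hAV h)
/-- B is WEAKER than FC (mod AVX). -/
theorem b_of_fc (hAV : SymPowerAvatarExists) (h : CMSymmetricPowerAutomorphy) : ThetaSeededSymPower := b_of_spf (spf_of_fc hAV h)
/-- C is WEAKER than FC (mod AVX). -/
theorem c_of_fc (hAV : SymPowerAvatarExists) (h : CMSymmetricPowerAutomorphy) : SeedIsolatedSymPower := c_of_spf (spf_of_fc hAV h)

/-- FRAME certified from the HOST: the host route's other items turn SPF into Langlands (`SymmetricPowerAnchorSplit.closes` with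
its FC binder fed by `fc_of_spf`). -/
theorem frame_of_host (hRES : AnchorlessSymTypeAutomorphy) (hLS : LowSymmetricPowerAutomorphy) (hFT : HilbertSymmetricPowerAutomorphy)
    (hCSD : CliffordSolvableDescent) (hT : SolvableAnchorTransport) (hF : AvatarSymmetricPowerFrame) : SeedReachFrame :=
  fun hSPF => Summit.Langlands.Langlands.Theses.SymmetricPowerAnchorSplit.closes hRES (fc_of_spf hSPF) hLS hFT hCSD hT hF

/-- DECIDING THEOREM of the child route (its glue is this, spelled out in pure logic): A → B → C → FRAME → Langlands. -/
theorem closes (hA : BaseChangeSeededSymPower) (hB : ThetaSeededSymPower) (hC : SeedIsolatedSymPower) (hF : SeedReachFrame) :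
    _root_.Langlands :=
  hF (spf_of_pieces hA hB hC)

/-- Langlands through the host: A → B → C → (host's RES LS FT CSD T′ FRAME′) → Langlands. -/
theorem langlands_of_pieces (hA : BaseChangeSeededSymPower) (hB : ThetaSeededSymPower) (hC : SeedIsolatedSymPower)
    (hRES : AnchorlessSymTypeAutomorphy) (hLS : LowSymmetricPowerAutomorphy) (hFT : HilbertSymmetricPowerAutomorphy)
    (hCSD : CliffordSolvableDescent) (hT : SolvableAnchorTransport) (hF : AvatarSymmetricPowerFrame) : _root_.Langlands :=
  closes hA hB hC (frame_of_host hRES hLS hFT hCSD hT hF)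

/-- NECESSITY certificates: Langlands ⟹ every item (SPF and the pieces modulo AVX; the frame outright). SPF first. -/
theorem spf_of_langlands (hAV : SymPowerAvatarExists) (hL : _root_.Langlands) : SymPowerFunctoriality := spf_of_fc hAV (cm_of_langlands hL)
/-- Langlands ⟹ A (mod AVX). -/
theorem a_of_langlands (hAV : SymPowerAvatarExists) (hL : _root_.Langlands) : BaseChangeSeededSymPower := a_of_spf (spf_of_langlands hAV hL)
/-- Langlands ⟹ B (mod AVX). -/
theorem b_of_langlands (hAV : SymPowerAvatarExists) (hL : _root_.Langlands) : ThetaSeededSymPower := b_of_spf (spf_of_langlands hAV hL)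
/-- Langlands ⟹ C (mod AVX). -/
theorem c_of_langlands (hAV : SymPowerAvatarExists) (hL : _root_.Langlands) : SeedIsolatedSymPower := c_of_spf (spf_of_langlands hAV hL)
/-- Langlands ⟹ FRAME″ (trivially). -/
theorem frame_of_langlands (hL : _root_.Langlands) : SeedReachFrame := fun _ => hL

/-- Langlands ⟺ the four child items, given AVX (→) — the child route literally decides the summit. -/
theorem langlands_iff_items (hAV : SymPowerAvatarExists) :
    _root_.Langlands ↔ (BaseChangeSeededSymPower ∧ ThetaSeededSymPower ∧ SeedIsolatedSymPower ∧ SeedReachFrame) :=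
  ⟨fun hL => ⟨a_of_langlands hAV hL, b_of_langlands hAV hL, c_of_langlands hAV hL, frame_of_langlands hL⟩,
   fun h => closes h.1 h.2.1 h.2.2.1 h.2.2.2⟩

end Summit.Langlands.Langlands.Theorems.SeedReach
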